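import Mathlib
import HarnessLib
import Literature.Probability.LatticeModels.TorusFourierMomentBound
import Summits.HubbardSuperconductivity.HubbardSuperconductivity.Theorems.KLProgrammeKLRegimeCountertermMuFlow

/-!
# Route `KLProgramme`, crux K3 (stmt-HubbardSuperconductivity-19937) — the `symInterp` TOOLKIT, part 1: the `C₄ᵥ`-symmetrised
# trigonometric interpolant IS an interpolant (exact at every lattice momentum for `D₄`-symmetric data), its value at any
# momentum as a position-space sum, and the sup / coefficient-weight bounds

Cell gate-hubbard-kl, seat p1b (g4).  P2-C4B §8.5 «Lean-now pieces (i) `symInterp` interpolation property for D₄-symmetric data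
(DFT on (ZMod L)²), (ii) derivative bounds of `symInterp.eval` from position-space moments» — prerequisites of child 2's remaining stub
`CtOneVolume` (the exact fixed point `K* = −Σ_n ℓ_n^G(K*)` of the counterterm map has `ν_N(K*)(θ)` equal to the OFF-lattice
interpolation error of `klFrameExtG` at the Fermi point, which is controlled by exactness AT lattice momenta plus derivative bounds)
and of the engine's reading lemmas ((E3a-G) sizes, `TwoLegSlopes`), all of which read `symInterp` (`…SplitPredicates` §4):
`symInterp L f := ⟨L, (m,n) ↦ Σ_{x : |x̃₀| = m, |x̃₁| = n} f_c(x)⟩`, `f_c(x) = torusCosCoeff L f x = L⁻² Σ_k f(k) cos(p_k · x̃)`.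

Content (all PROVED, no new definitions):
* §1 phases at lattice momenta are character values: `cos(Σᵢ p_{q,i}·aᵢ) = Re χ_q(y)` whenever `aᵢ ≡ yᵢ (mod L)`
  (`cos_latticeMomentum_phase_eq_re`), so `torusCosCoeff L f x = L⁻²·Re Σ_k f(k) χ_k(x)` (`torusCosCoeff_eq_re`) — the tree's characters
  `torusChar` of `Literature/Probability/LatticeModels/TorusFourierProofs` and their orthogonality `sum_torusChar_right` do the work;
* §2 from the value formula `eval_symInterp` (hubbard-kl-k3c3-p1, `…CountertermMuFlow`; generic form `eval_indicatorTable` here):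
  `|(symInterp L f).eval p| ≤ Σ_x |f_c(x)|` and `coeffNorm r (symInterp L f) ≤ Σ_x (1 + |x̃₀| + |x̃₁|)^r |f_c(x)|`
  (position-space moments control the frame's regularity sizes);
* §3 `D₄` transport: `f` invariant under `k ↦ (k₀, −k₁)` / `k ↦ (k₁, k₀)` ⇒ so is `f_c`; `f` even ⇒ `Σ_k f(k) χ_k(x)` is real;
* §4 **`symInterp_eval_latticeMomentum`**: for `f` even, reflection- and swap-invariant,
  `(symInterp L f).eval (latticeMomentum L q) = f q` for every `q : TorusSite 2 L`.
Nothing is asserted about the model.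
-/

noncomputable section

namespace Summit.HubbardSuperconductivity.HubbardSuperconductivity.Theorems.KLRegimeSplit

set_option linter.dupNamespace false -- summit = problem name (single-conjunct summit), D-0017

open Real Finset Literature.MathematicalPhysics.QuantumLattice Literature.Probability.LatticeModels
open scoped ComplexConjugate

variable {L : ℕ} [NeZero L]

/-! ## §1 Phases at lattice momenta are character values -/

/-- **Lattice phases are character values**: for integers `aᵢ ≡ yᵢ (mod L)`,
`cos(Σᵢ p_{q,i}·aᵢ) = Re χ_q(y)` (`p_q = latticeMomentum L q = 2πq/L`). -/
theorem cos_latticeMomentum_phase_eq_re {d : ℕ} (q y : TorusSite d L) (a : Fin d → ℤ)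
    (ha : ∀ i, ((a i : ℤ) : ZMod L) = y i) :
    Real.cos (∑ i, latticeMomentum L q i * (a i : ℝ)) = (torusChar q y).re := by
  have hfac : ∀ i, (ZMod.stdAddChar (q i * y i) : ℂ) =
      Complex.exp (((latticeMomentum L q i * (a i : ℝ) : ℝ) : ℂ) * Complex.I) := by
    intro i
    have hqy : q i * y i = ((((q i).val : ℤ) * a i : ℤ) : ZMod L) := by
      push_cast
      rw [ZMod.natCast_zmod_val, ha i]
    rw [hqy, ZMod.stdAddChar_coe]
    congr 1
    simp only [latticeMomentum]
    push_cast
    ring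
  have h : torusChar q y = Complex.exp (((∑ i, latticeMomentum L q i * (a i : ℝ) : ℝ) : ℂ) * Complex.I) := by
    unfold torusChar
    rw [Finset.prod_congr rfl fun i _ => hfac i, ← Complex.exp_sum]
    congr 1
    push_cast
    rw [Finset.sum_mul]
  rw [h, Complex.exp_ofReal_mul_I_re]

/-- The `valMinAbs` phase of the definition of `torusCosCoeff` is a character value: `cos(p_q · x̃) = Re χ_q(x)`. -/
theorem cos_latticeMomentum_valMinAbs_eq_re {d : ℕ} (q x : TorusSite d L) :
    Real.cos (∑ i, latticeMomentum L q i * ((x i).valMinAbs : ℝ)) = (torusChar q x).re :=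
  cos_latticeMomentum_phase_eq_re q x (fun i => (x i).valMinAbs) fun i => ZMod.coe_valMinAbs (x i)

/-- Two-dimensional form: `cos(p_{q,0}·a + p_{q,1}·b) = Re χ_q(y)` for `a ≡ y₀`, `b ≡ y₁ (mod L)`. -/
theorem cos_latticeMomentum_phase_two (q y : TorusSite 2 L) (a b : ℤ) (ha : ((a : ℤ) : ZMod L) = y 0)
    (hb : ((b : ℤ) : ZMod L) = y 1) :
    Real.cos (latticeMomentum L q 0 * (a : ℝ) + latticeMomentum L q 1 * (b : ℝ)) = (torusChar q y).re := by
  have h := cos_latticeMomentum_phase_eq_re q y ![a, b] (fun i => by fin_cases i <;> simp [ha, hb])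
  simpa [Fin.sum_univ_two] using h

/-- **`torusCosCoeff` through characters**: `f_c(x) = L⁻² · Re Σ_k f(k) χ_k(x)`. -/
theorem torusCosCoeff_eq_re (f : TorusSite 2 L → ℝ) (x : TorusSite 2 L) :
    torusCosCoeff L f x = ((L : ℝ) ^ 2)⁻¹ * (∑ k, (f k : ℂ) * torusChar k x).re := by
  unfold torusCosCoeff
  congr 1
  rw [Complex.re_sum]
  refine Finset.sum_congr rfl fun k _ => ?_
  rw [Complex.re_ofReal_mul, cos_latticeMomentum_valMinAbs_eq_re]

/-! ## §2 The interpolant's value at any momentum as a position-space sum; sup and coefficient-weight bounds -/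

/-- Evaluation of a frame whose coefficient table is an indicator sum: if `α x, β x ≤ D` for all `x`, then
`eval ⟨D, (m,n) ↦ Σ_x [α x = m ∧ β x = n]·c x⟩ p = Σ_x c x · h_{α x, β x}(p)`. -/
theorem eval_indicatorTable {ι : Type*} [Fintype ι] (D : ℕ) (α β : ι → ℕ) (c : ι → ℝ) (hα : ∀ x, α x ≤ D)
    (hβ : ∀ x, β x ≤ D) (p : Fin 2 → ℝ) :
    (⟨D, fun m n => ∑ x, if (α x = m ∧ β x = n) then c x else 0⟩ : TrigPolyC4v).eval p =
      ∑ x, c x * TrigPolyC4v.harmonic (α x) (β x) p := by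
  rw [TrigPolyC4v.eval_def]
  dsimp only
  have hαm : ∀ x, α x ∈ range (D + 1) := fun x => mem_range.2 (Nat.lt_succ_of_le (hα x))
  have hβm : ∀ x, β x ∈ range (D + 1) := fun x => mem_range.2 (Nat.lt_succ_of_le (hβ x))
  set F : ℕ → ℕ → ι → ℝ := fun m n x => if (α x = m ∧ β x = n) then c x * TrigPolyC4v.harmonic m n p else 0
    with hF
  have h1 : ∀ m n, (∑ x, if (α x = m ∧ β x = n) then c x else 0) * TrigPolyC4v.harmonic m n p = ∑ x, F m n x := by
    intro m n
    rw [sum_mul]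
    refine sum_congr rfl fun x _ => ?_
    simp only [hF]
    split_ifs <;> simp
  simp_rw [h1]
  have h2 : ∑ m ∈ range (D + 1), ∑ n ∈ range (D + 1), ∑ x, F m n x =
      ∑ x, ∑ m ∈ range (D + 1), ∑ n ∈ range (D + 1), F m n x := by
    rw [show (∑ m ∈ range (D + 1), ∑ n ∈ range (D + 1), ∑ x, F m n x) =
        ∑ m ∈ range (D + 1), ∑ x, ∑ n ∈ range (D + 1), F m n x from sum_congr rfl fun m _ => sum_comm,
      sum_comm]
  rw [h2]
  refine sum_congr rfl fun x _ => ?_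
  rw [Finset.sum_eq_single (α x)]
  · rw [Finset.sum_eq_single (β x)]
    · simp [hF]
    · intro n _ hn
      simp [hF, Ne.symm hn]
    · intro h; exact absurd (hβm x) h
  · intro m _ hm
    exact Finset.sum_eq_zero fun n _ => by simp [hF, Ne.symm hm]
  · intro h; exact absurd (hαm x) h

/-- `|x̃ᵢ| ≤ L` for every component of a torus site (in fact `≤ L/2`). -/
theorem natAbs_valMinAbs_le_card (x : TorusSite 2 L) (i : Fin 2) : (x i).valMinAbs.natAbs ≤ L :=
  (ZMod.natAbs_valMinAbs_le (x i)).trans (Nat.div_le_self L 2)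

/-- **Sup bound**: `|(symInterp L f).eval p| ≤ Σ_x |f_c(x)|` at every momentum `p`. -/
theorem abs_symInterp_eval_le (f : TorusSite 2 L → ℝ) (p : Fin 2 → ℝ) :
    |(symInterp L f).eval p| ≤ ∑ x : TorusSite 2 L, |torusCosCoeff L f x| := by
  rw [eval_symInterp]
  refine (abs_sum_le_sum_abs _ _).trans (sum_le_sum fun x _ => ?_)
  rw [abs_mul]
  exact mul_le_of_le_one_right (abs_nonneg _) (TrigPolyC4v.abs_harmonic_le_one _ _ _)

/-- The coefficient weight of an indicator-table frame is at most the weighted `ℓ¹` sum of its entries. -/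
theorem coeffNorm_indicatorTable_le {ι : Type*} [Fintype ι] (D : ℕ) (α β : ι → ℕ) (c : ι → ℝ) (hα : ∀ x, α x ≤ D)
    (hβ : ∀ x, β x ≤ D) (r : ℕ) :
    (⟨D, fun m n => ∑ x, if (α x = m ∧ β x = n) then c x else 0⟩ : TrigPolyC4v).coeffNorm r ≤
      ∑ x, (1 + α x + β x : ℝ) ^ r * |c x| := by
  unfold TrigPolyC4v.coeffNorm
  dsimp only
  have hαm : ∀ x, α x ∈ range (D + 1) := fun x => mem_range.2 (Nat.lt_succ_of_le (hα x))
  have hβm : ∀ x, β x ∈ range (D + 1) := fun x => mem_range.2 (Nat.lt_succ_of_le (hβ x))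
  set F : ℕ → ℕ → ι → ℝ := fun m n x => if (α x = m ∧ β x = n) then (1 + m + n : ℝ) ^ r * |c x| else 0 with hF
  have h1 : ∀ m n : ℕ, ((1 : ℝ) + m + n) ^ r * |∑ x, if (α x = m ∧ β x = n) then c x else 0| ≤ ∑ x, F m n x := by
    intro m n
    calc ((1 : ℝ) + m + n) ^ r * |∑ x, if (α x = m ∧ β x = n) then c x else 0|
        ≤ ((1 : ℝ) + m + n) ^ r * ∑ x, |if (α x = m ∧ β x = n) then c x else 0| :=
          mul_le_mul_of_nonneg_left (abs_sum_le_sum_abs _ _) (by positivity)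
      _ = ∑ x, F m n x := by
          rw [mul_sum]
          refine sum_congr rfl fun x _ => ?_
          simp only [hF]
          split_ifs <;> simp
  have h2 : ∑ m ∈ range (D + 1), ∑ n ∈ range (D + 1), ∑ x, F m n x =
      ∑ x, ∑ m ∈ range (D + 1), ∑ n ∈ range (D + 1), F m n x := by
    rw [show (∑ m ∈ range (D + 1), ∑ n ∈ range (D + 1), ∑ x, F m n x) =
        ∑ m ∈ range (D + 1), ∑ x, ∑ n ∈ range (D + 1), F m n x from sum_congr rfl fun m _ => sum_comm,
      sum_comm]
  have h3 : ∀ x, ∑ m ∈ range (D + 1), ∑ n ∈ range (D + 1), F m n x = (1 + α x + β x : ℝ) ^ r * |c x| := by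
    intro x
    rw [Finset.sum_eq_single (α x)]
    · rw [Finset.sum_eq_single (β x)]
      · simp [hF]
      · intro n _ hn
        simp [hF, Ne.symm hn]
      · intro h; exact absurd (hβm x) h
    · intro m _ hm
      exact Finset.sum_eq_zero fun n _ => by simp [hF, Ne.symm hm]
    · intro h; exact absurd (hαm x) h
  calc ∑ m ∈ range (D + 1), ∑ n ∈ range (D + 1), ((1 : ℝ) + m + n) ^ r * |∑ x, if (α x = m ∧ β x = n) then c x else 0|
      ≤ ∑ m ∈ range (D + 1), ∑ n ∈ range (D + 1), ∑ x, F m n x := sum_le_sum fun m _ => sum_le_sum fun n _ => h1 m n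
    _ = ∑ x, (1 + α x + β x : ℝ) ^ r * |c x| := by rw [h2]; exact sum_congr rfl fun x _ => h3 x

/-- **Coefficient-weight bound** (the frame's regularity sizes from position-space moments):
`coeffNorm r (symInterp L f) ≤ Σ_x (1 + |x̃₀| + |x̃₁|)^r · |f_c(x)|`. -/
theorem coeffNorm_symInterp_le (f : TorusSite 2 L → ℝ) (r : ℕ) :
    (symInterp L f).coeffNorm r ≤
      ∑ x : TorusSite 2 L, (1 + (x 0).valMinAbs.natAbs + (x 1).valMinAbs.natAbs : ℝ) ^ r * |torusCosCoeff L f x| := by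
  unfold symInterp
  exact coeffNorm_indicatorTable_le L (fun x : TorusSite 2 L => (x 0).valMinAbs.natAbs) (fun x => (x 1).valMinAbs.natAbs)
    (torusCosCoeff L f) (fun x => natAbs_valMinAbs_le_card x 0) (fun x => natAbs_valMinAbs_le_card x 1) r

/-! ## §3 `D₄` transport: symmetries of the data pass to the cosine coefficients; even data have real character sums -/

/-- `χ_k(x₀, −x₁) = χ_{(k₀, −k₁)}(x)`. -/
theorem torusChar_reflect (k x : TorusSite 2 L) : torusChar k ![x 0, -x 1] = torusChar ![k 0, -k 1] x := by
  simp only [torusChar, Fin.prod_univ_two, Matrix.cons_val_zero, Matrix.cons_val_one, mul_neg, neg_mul]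

/-- `χ_k(x₁, x₀) = χ_{(k₁, k₀)}(x)`. -/
theorem torusChar_swap (k x : TorusSite 2 L) : torusChar k ![x 1, x 0] = torusChar ![k 1, k 0] x := by
  simp only [torusChar, Fin.prod_univ_two, Matrix.cons_val_zero, Matrix.cons_val_one]
  ring

/-- `χ_k(−x) = χ_{−k}(x)`. -/
theorem torusChar_neg_right_eq_neg_left {d : ℕ} (k x : TorusSite d L) : torusChar k (-x) = torusChar (-k) x := by
  simp only [torusChar, Pi.neg_apply, mul_neg, neg_mul]

omit [NeZero L] in
/-- The reflection `x ↦ (x₀, −x₁)` of the torus sites is an involution. -/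
theorem siteReflect_involutive : Function.Involutive (fun x : TorusSite 2 L => ![x 0, -x 1]) := by
  intro x; ext i; fin_cases i <;> simp

omit [NeZero L] in
/-- The swap `x ↦ (x₁, x₀)` of the torus sites is an involution. -/
theorem siteSwap_involutive : Function.Involutive (fun x : TorusSite 2 L => ![x 1, x 0]) := by
  intro x; ext i; fin_cases i <;> simp

/-- **Reflection-invariant data have reflection-invariant character sums.** -/
theorem sum_mul_torusChar_reflect (f : TorusSite 2 L → ℝ) (hrefl : ∀ k, f ![k 0, -k 1] = f k) (x : TorusSite 2 L) :
    ∑ k, (f k : ℂ) * torusChar k ![x 0, -x 1] = ∑ k, (f k : ℂ) * torusChar k x := by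
  simp_rw [torusChar_reflect]
  exact Fintype.sum_equiv (siteReflect_involutive.toPerm _) _ _ fun k => by
    simp [Function.Involutive.coe_toPerm, hrefl]

/-- **Swap-invariant data have swap-invariant character sums.** -/
theorem sum_mul_torusChar_swap (f : TorusSite 2 L → ℝ) (hswap : ∀ k, f ![k 1, k 0] = f k) (x : TorusSite 2 L) :
    ∑ k, (f k : ℂ) * torusChar k ![x 1, x 0] = ∑ k, (f k : ℂ) * torusChar k x := by
  simp_rw [torusChar_swap]
  exact Fintype.sum_equiv (siteSwap_involutive.toPerm _) _ _ fun k => by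
    simp [Function.Involutive.coe_toPerm, hswap]

/-- `f_c(x₀, −x₁) = f_c(x)` for reflection-invariant `f`. -/
theorem torusCosCoeff_reflect (f : TorusSite 2 L → ℝ) (hrefl : ∀ k, f ![k 0, -k 1] = f k) (x : TorusSite 2 L) :
    torusCosCoeff L f ![x 0, -x 1] = torusCosCoeff L f x := by
  rw [torusCosCoeff_eq_re, torusCosCoeff_eq_re, sum_mul_torusChar_reflect f hrefl]

/-- `f_c(x₁, x₀) = f_c(x)` for swap-invariant `f`. -/
theorem torusCosCoeff_swap (f : TorusSite 2 L → ℝ) (hswap : ∀ k, f ![k 1, k 0] = f k) (x : TorusSite 2 L) :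
    torusCosCoeff L f ![x 1, x 0] = torusCosCoeff L f x := by
  rw [torusCosCoeff_eq_re, torusCosCoeff_eq_re, sum_mul_torusChar_swap f hswap]

/-- `f_c(x₁, −x₀) = f_c(x)` (the composite of swap and reflection) for reflection- and swap-invariant `f`. -/
theorem torusCosCoeff_rot (f : TorusSite 2 L → ℝ) (hrefl : ∀ k, f ![k 0, -k 1] = f k) (hswap : ∀ k, f ![k 1, k 0] = f k)
    (x : TorusSite 2 L) : torusCosCoeff L f ![x 1, -x 0] = torusCosCoeff L f x := by
  have h1 := torusCosCoeff_reflect f hrefl ![x 1, x 0]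
  simp only [Matrix.cons_val_zero, Matrix.cons_val_one] at h1
  rw [h1, torusCosCoeff_swap f hswap]

/-- **Even data have REAL character sums**: `conj (Σ_k f(k) χ_k(x)) = Σ_k f(k) χ_k(x)` when `f(−k) = f(k)`. -/
theorem conj_sum_mul_torusChar_of_even (f : TorusSite 2 L → ℝ) (heven : ∀ k, f (-k) = f k) (x : TorusSite 2 L) :
    conj (∑ k, (f k : ℂ) * torusChar k x) = ∑ k, (f k : ℂ) * torusChar k x := by
  rw [map_sum]
  simp_rw [map_mul, Complex.conj_ofReal, ← torusChar_neg_right, torusChar_neg_right_eq_neg_left]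
  exact Fintype.sum_equiv (Equiv.neg _) _ _ fun k => by simp [heven]

/-- The imaginary part of the character sum of even data vanishes. -/
theorem im_sum_mul_torusChar_of_even (f : TorusSite 2 L → ℝ) (heven : ∀ k, f (-k) = f k) (x : TorusSite 2 L) :
    (∑ k, (f k : ℂ) * torusChar k x).im = 0 :=
  Complex.conj_eq_iff_im.1 (conj_sum_mul_torusChar_of_even f heven x)

/-! ## §4 The interpolation theorem -/

/-- `cos(|a|·t) = cos(a·t)` for an integer `a`. -/
theorem cos_natAbs_mul (a : ℤ) (t : ℝ) : Real.cos ((a.natAbs : ℝ) * t) = Real.cos ((a : ℝ) * t) := by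
  rw [Nat.cast_natAbs, Int.cast_abs]
  rcases abs_choice (a : ℝ) with h | h
  · rw [h]
  · rw [h, neg_mul, Real.cos_neg]

/-- **The harmonic at a lattice momentum is a quarter-sum of four character values** over the `D₄`-images of the site:
`h_{|x̃₀|,|x̃₁|}(p_q) = ¼·Re[χ_q(x) + χ_q(x₀,−x₁) + χ_q(x₁,x₀) + χ_q(x₁,−x₀)]`. -/
theorem harmonic_latticeMomentum_eq_re (q x : TorusSite 2 L) :
    TrigPolyC4v.harmonic (x 0).valMinAbs.natAbs (x 1).valMinAbs.natAbs (latticeMomentum L q) =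
      ((torusChar q x).re + (torusChar q ![x 0, -x 1]).re + (torusChar q ![x 1, x 0]).re +
        (torusChar q ![x 1, -x 0]).re) / 4 := by
  set a : ℤ := (x 0).valMinAbs with ha
  set b : ℤ := (x 1).valMinAbs with hb
  have ha0 : ((a : ℤ) : ZMod L) = x 0 := ZMod.coe_valMinAbs (x 0)
  have hb1 : ((b : ℤ) : ZMod L) = x 1 := ZMod.coe_valMinAbs (x 1)
  have hna : ((-a : ℤ) : ZMod L) = -x 0 := by rw [Int.cast_neg, ha0]
  have hnb : ((-b : ℤ) : ZMod L) = -x 1 := by rw [Int.cast_neg, hb1]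
  -- the four phases
  have c1 : Real.cos (latticeMomentum L q 0 * a + latticeMomentum L q 1 * b) = (torusChar q x).re :=
    cos_latticeMomentum_phase_two q x a b ha0 hb1
  have c2 : Real.cos (latticeMomentum L q 0 * a - latticeMomentum L q 1 * b) = (torusChar q ![x 0, -x 1]).re := by
    have h := cos_latticeMomentum_phase_two q ![x 0, -x 1] a (-b) (by simpa using ha0) (by simpa using hnb)
    rw [← h]; push_cast; ring_nf
  have c3 : Real.cos (latticeMomentum L q 0 * b + latticeMomentum L q 1 * a) = (torusChar q ![x 1, x 0]).re :=
    cos_latticeMomentum_phase_two q ![x 1, x 0] b a (by simpa using hb1) (by simpa using ha0)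
  have c4 : Real.cos (latticeMomentum L q 0 * b - latticeMomentum L q 1 * a) = (torusChar q ![x 1, -x 0]).re := by
    have h := cos_latticeMomentum_phase_two q ![x 1, -x 0] b (-a) (by simpa using hb1) (by simpa using hna)
    rw [← h]; push_cast; ring_nf
  -- products to sums
  unfold TrigPolyC4v.harmonic
  rw [cos_natAbs_mul, cos_natAbs_mul, cos_natAbs_mul, cos_natAbs_mul, ← c1, ← c2, ← c3, ← c4]
  rw [show (a : ℝ) * latticeMomentum L q 0 = latticeMomentum L q 0 * a by ring,
    show (b : ℝ) * latticeMomentum L q 1 = latticeMomentum L q 1 * b by ring,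
    show (b : ℝ) * latticeMomentum L q 0 = latticeMomentum L q 0 * b by ring,
    show (a : ℝ) * latticeMomentum L q 1 = latticeMomentum L q 1 * a by ring]
  have e1 : Real.cos (latticeMomentum L q 0 * a) * Real.cos (latticeMomentum L q 1 * b) =
      (Real.cos (latticeMomentum L q 0 * a + latticeMomentum L q 1 * b) +
        Real.cos (latticeMomentum L q 0 * a - latticeMomentum L q 1 * b)) / 2 := by
    rw [Real.cos_add, Real.cos_sub]; ring
  have e2 : Real.cos (latticeMomentum L q 0 * b) * Real.cos (latticeMomentum L q 1 * a) =
      (Real.cos (latticeMomentum L q 0 * b + latticeMomentum L q 1 * a) +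
        Real.cos (latticeMomentum L q 0 * b - latticeMomentum L q 1 * a)) / 2 := by
    rw [Real.cos_add, Real.cos_sub]; ring
  rw [e1, e2]
  ring

/-- **THE INTERPOLATION THEOREM.**  For `D₄`-symmetric lattice data — `f` even, invariant under the reflection `k ↦ (k₀, −k₁)` and
under the swap `k ↦ (k₁, k₀)` — the `C₄ᵥ`-symmetrised trigonometric interpolant takes the value `f(q)` at every lattice momentum:
`(symInterp L f).eval (latticeMomentum L q) = f q`. -/
theorem symInterp_eval_latticeMomentum (f : TorusSite 2 L → ℝ) (heven : ∀ k, f (-k) = f k)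
    (hrefl : ∀ k, f ![k 0, -k 1] = f k) (hswap : ∀ k, f ![k 1, k 0] = f k) (q : TorusSite 2 L) :
    (symInterp L f).eval (latticeMomentum L q) = f q := by
  rw [eval_symInterp]
  simp_rw [harmonic_latticeMomentum_eq_re]
  -- the four `D₄`-images contribute the same sum `S = Σ_x f_c(x)·Re χ_q(x)`
  set S : ℝ := ∑ x : TorusSite 2 L, torusCosCoeff L f x * (torusChar q x).re with hS
  have e1 : ∑ x : TorusSite 2 L, torusCosCoeff L f x * (torusChar q ![x 0, -x 1]).re = S := by
    rw [hS]
    refine Fintype.sum_equiv (siteReflect_involutive.toPerm _) _ _ fun x => ?_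
    simp only [Function.Involutive.coe_toPerm]
    rw [torusCosCoeff_reflect f hrefl]
  have e2 : ∑ x : TorusSite 2 L, torusCosCoeff L f x * (torusChar q ![x 1, x 0]).re = S := by
    rw [hS]
    refine Fintype.sum_equiv (siteSwap_involutive.toPerm _) _ _ fun x => ?_
    simp only [Function.Involutive.coe_toPerm]
    rw [torusCosCoeff_swap f hswap]
  have e3 : ∑ x : TorusSite 2 L, torusCosCoeff L f x * (torusChar q ![x 1, -x 0]).re = S := by
    rw [hS]
    refine Fintype.sum_equiv ((siteSwap_involutive.toPerm _).trans (siteReflect_involutive.toPerm _)) _ _ fun x => ?_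
    simp only [Equiv.trans_apply, Function.Involutive.coe_toPerm, Matrix.cons_val_zero, Matrix.cons_val_one]
    rw [torusCosCoeff_rot f hrefl hswap]
  have hsplit : ∑ x : TorusSite 2 L, torusCosCoeff L f x *
      (((torusChar q x).re + (torusChar q ![x 0, -x 1]).re + (torusChar q ![x 1, x 0]).re +
        (torusChar q ![x 1, -x 0]).re) / 4) =
      (S + ∑ x : TorusSite 2 L, torusCosCoeff L f x * (torusChar q ![x 0, -x 1]).re +
        ∑ x : TorusSite 2 L, torusCosCoeff L f x * (torusChar q ![x 1, x 0]).re +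
        ∑ x : TorusSite 2 L, torusCosCoeff L f x * (torusChar q ![x 1, -x 0]).re) / 4 := by
    rw [hS, ← sum_add_distrib, ← sum_add_distrib, ← sum_add_distrib, Finset.sum_div]
    exact sum_congr rfl fun x _ => by ring
  rw [hsplit, e1, e2, e3, show (S + S + S + S) / 4 = S by ring, hS]
  -- `S = f q` by Fourier inversion
  simp_rw [torusCosCoeff_eq_re]
  have hreal : ∀ x : TorusSite 2 L, ((L : ℝ) ^ 2)⁻¹ * (∑ k, (f k : ℂ) * torusChar k x).re * (torusChar q x).re =
      ((L : ℝ) ^ 2)⁻¹ * ((∑ k, (f k : ℂ) * torusChar k x) * torusChar q x).re := by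
    intro x
    rw [Complex.mul_re, im_sum_mul_torusChar_of_even f heven x, zero_mul, sub_zero, mul_assoc]
  simp_rw [hreal]
  rw [← mul_sum, ← Complex.re_sum]
  have hsum : ∑ x : TorusSite 2 L, (∑ k, (f k : ℂ) * torusChar k x) * torusChar q x = (f (-q) : ℂ) * (L : ℂ) ^ 2 := by
    have h1 : ∑ x : TorusSite 2 L, (∑ k, (f k : ℂ) * torusChar k x) * torusChar q x =
        ∑ k : TorusSite 2 L, (f k : ℂ) * ∑ x, torusChar (k + q) x := by
      simp_rw [sum_mul, mul_sum, mul_assoc, ← torusChar_add_left]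
      exact sum_comm
    rw [h1]
    simp_rw [sum_torusChar_right, add_eq_zero_iff_eq_neg, mul_ite, mul_zero]
    rw [Finset.sum_ite_eq' univ (-q)]
    simp
  rw [hsum]
  have hL : (L : ℝ) ≠ 0 := Nat.cast_ne_zero.2 (NeZero.ne L)
  rw [show ((f (-q) : ℂ) * (L : ℂ) ^ 2).re = f (-q) * (L : ℝ) ^ 2 by
    rw [← Complex.ofReal_natCast, ← Complex.ofReal_pow, ← Complex.ofReal_mul, Complex.ofReal_re]]
  rw [heven q]
  field_simp

end Summit.HubbardSuperconductivity.HubbardSuperconductivity.Theorems.KLRegimeSplit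

end
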